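import Literature.NumberTheory.Rogawski1990.FinExplicitTransferFactorLeviStratum     -- ★ p840576 (F0P3b-p01 (g6)): `endoEmbLocal_mem_torusU_of_endoEmbLocal_eq`, `finGammaTwo_eq_of_endoEmbLocal_eq`, `eval_finCharpolyTwo_eq_of_endoEmbLocal_eq`; brings ★ `FinExplicitTransferFactorKappaEigenvector`
import Literature.NumberTheory.Automorphic.LocalUnitaryGroupSimilitude                  -- ★ `corresponds_cmDatumLocalCongr`, `cmDatumLocalCongr`, `coe_cmDatumLocalCongr_apply`
import HarnessLib

/-!
# `κ_v` and `Δ‴_v` on the LEVI stratum of an INNER FORM, read through the frame `e = cmDatumLocalCongr L v T ha h` (`ᵗ(T̄) H_v T = a • Φ₃`):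
# `κ_v(γ_H, e(ι_v γ_H)) = +1` iff the multiplier `a` is a norm, `−1` otherwise — it is NOT always `+1`
(Rogawski (1990), §4.9 p. 55 («on `M` the `κ`-orbital integral is the ordinary one» — for the QUASI-SPLIT group), §3.5 Prop. 3.5.2 (c) p. 29, §14.6 p. 242
(«`κ(γ, ψ_v(i(γ)))` is equal to `±1` and it is `+1` for almost all `v`»); Langlands–Shelstad (1987) §1–§2)

Topic `NumberTheory/Rogawski1990`; namespace `Literature.NumberTheory.Rogawski1990`.  THEOREMS ONLY (no definition, no instance, no notation, no named fact, no
`sorry`).  Cell `pub/hodgecm-mathlib`, line «CMCharIdentityTest» (F0P3b), desk F0P3b-plan (g12) PLAN v14 §10 brick **S3 «ONE-TERM TRANSFER ON THE LEVI STRATUM»**,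
FILE S3-B = the SIGN THEOREM (desk NOTICE «κ-SIGN» 08:22:19Z: «S3-B before S3-A — it is the kernel evidence and the token everybody needs»); seat F0P3b-p01 (g7).
HONEST LABEL: HC_CM is proved only modulo the 2 remaining named inputs (hLiu418, h413) until rung 0 closes; this file proves no letter — it COMPUTES the tree's transfer
factor of record ★ `finExplicitDelta = finTau · finWeylRatio · finKappaAt` on the Levi stratum of the inner form, where the (N-492) ∕ (N-1273) ∕ Q-CM-T letters live.

THE COMPUTATION.  `H` hermitian (any), `v` a NON-SPLIT finite place of `L⁺` (`w ∣ v`, `c • w = w`, so `E_v = L_w` is a field and the tree's `κ_v` is the «unit norm»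
test of ★ `FinExplicitTransferFactor` §4), a frame `T ∈ GL₃(E_v)` with `h : formCongr σ T H_v = a • Φ₃` (`a` a `σ`-fixed unit; ★ `cmDatumLocalCongr L v T ha h = e :
U(Φ₃)(L⁺_v) ≃ₜ* U(H)(L⁺_v)`, `e g = T g T⁻¹`), and `γ_H ∈ H_v` on the LEVI STRATUM: `ι_v(γ_H) = diag(d₀, d₁, d₂)` with the `dᵢ − dⱼ` units.  Then
`γ₀ := e(ι_v γ_H) = T diag(d) T⁻¹` is a norm pair of `γ_H` (★ `corresponds_cmDatumLocalCongr`), its `u = d₁`-eigenline is spanned by the column `p′ = T e₁`, and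
`x₀(p′) = Σ_{i,k} σ(T_{i1}) (H_v)_{ik} T_{k1} = (formCongr σ T H_v)₁₁ = (a • Φ₃)₁₁ = a`.  By ★ `finKappaAt_eq_ite_of_eigenvector`:
* **`finKappaAt_cmDatumLocalCongr_endoEmbLocal_eq_ite`**: `κ_v(γ_H, e(ι_v γ_H)) = if (∃ z, IsUnit z ∧ a = z · σ z) then 1 else −1` — i.e. `ω_{L_w∕L⁺_v}(a)`, CONSTANT on the
  stratum; since `N(det T) · det H = det(a Φ₃) = −a³` and `a² = N(a)`, `a ≡ −det H` modulo norms, so the sign is `ω_w(−det H)`, independent of the frame, `+1` for almost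
  all `v` (★ `finKappaAt_eq_one_of_levi_of_nonsplit` is the good-reduction case `a = 1`) but `−1` e.g. for `L = ℚ(i)`, `H = 1₃`, `v = 2`;
* **`finExplicitDelta_cmDatumLocalCongr_endoEmbLocal_eq`**: `Δ‴_v(γ_H, e(ι_v γ_H)) = τ_v(γ_H) · D_v(γ_H) · (that sign)`, with the two corollaries
  `…_of_exists` (`a` a unit norm: `= τ_v · D_v`) and `…_of_not_exists` (`= −(τ_v · D_v)`).
CONSEQUENCE (desk NOTICE «κ-SIGN», census `CENSUS-S3-LeviOneTerm-KappaSign` c1cd5fbb76238132): the tree's `Δ‴_v` on the inner form equals print's TRANSPORTED factor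
times `ε_v(H) = ω_w(−det H)`; every local identity transported from print along `e` carries `ε_v` on the `G`-side (Lemma 4.9.2: `tr i_H(χ_H)(f^H) = ε_v · tr(i_G(χ′) ∘ e⁻¹)(f)`).

## References
* [Rogawski1990] J. D. Rogawski, *Automorphic Representations of Unitary Groups in Three Variables*, Ann. of Math. Stud. 123 (1990): §4.9 p. 55, Lemma 4.9.2 p. 56;
  §3.5 Prop. 3.5.2 (c) p. 29; §4.3 p. 43; §14.6 p. 242.
* [LanglandsShelstad1987] R. P. Langlands, D. Shelstad, *On the definition of transfer factors*, Math. Ann. 278 (1987), §1–§2.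
-/

set_option autoImplicit false

noncomputable section

open MeasureTheory Measure Set NumberField IsDedekindDomain Matrix
open Literature.NumberTheory.Automorphic Literature.NumberTheory.Automorphic.UnitaryGroup
open Literature.NumberTheory.GaloisRepresentations
open scoped NNReal Matrix MatrixGroups

namespace Literature.NumberTheory.Rogawski1990

variable (L : Type) [Field L] [NumberField L] [IsCMField L]

open scoped Classical in
/-- **`κ_v` ON THE LEVI STRATUM OF THE INNER FORM, THROUGH THE FRAME `e = cmDatumLocalCongr L v T ha h`** (`ᵗ(T̄) H_v T = a • Φ₃`, `v` NON-SPLIT, `ι_v(γ_H) = diag(d)`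
regular): **`finKappaAt L v H γ_H (e (ι_v γ_H)) = if (∃ z, IsUnit z ∧ a = z · σ z) then 1 else −1`** — the value `ω_{L_w∕L⁺_v}(a)` of the endoscopic character on the
class of the multiplier `a` (★ `finKappaAt_eq_ite_of_eigenvector` at the `u = d₁`-eigenvector `p′ = T e₁` of `e(ι_v γ_H) = T diag(d) T⁻¹`, whose relative position is
`x₀(p′) = (formCongr σ T H_v)₁₁ = (a • Φ₃)₁₁ = a`).  For the quasi-split group itself (`H = Φ₃`, `T = 1`, `a = 1`) this is print's «on `M` the `κ`-orbital integral is the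
ordinary one»; on an inner form the sign is `ω_w(−det H)` and can be `−1`. [cite: Rogawski1990, §4.9 p. 55; §3.5 Prop. 3.5.2 (c) p. 29; §14.6 p. 242]
[cite: LanglandsShelstad1987, §2] -/
theorem finKappaAt_cmDatumLocalCongr_endoEmbLocal_eq_ite (H : Matrix (Fin 3) (Fin 3) L)
    {v : HeightOneSpectrum (𝓞 ↥(maximalRealSubfield L))} (w : PlacesOver L v) (hw : IsCMField.complexConj L • w.1 = w.1)
    (T : GL (Fin 3) (UnitaryGroup.LocalRing L v)) {a : UnitaryGroup.LocalRing L v} (ha : IsUnit a)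
    (h : formCongr (conjLocal L (IsCMField.complexConj L) v) T (H.map (algebraMap L (UnitaryGroup.LocalRing L v))) =
      a • (Matrix.of fun i j : Fin 3 => if i.val + j.val + 1 = 3 then (1 : L) else 0).map (algebraMap L (UnitaryGroup.LocalRing L v)))
    (γH : (cmDatum L 2 (Matrix.of fun i j : Fin 2 => if i.val + j.val + 1 = 2 then (1 : L) else 0)).Local v ×
      (cmDatum L 1 (Matrix.of fun i j : Fin 1 => if i.val + j.val + 1 = 1 then (1 : L) else 0)).Local v)
    {d : Fin 3 → (UnitaryGroup.LocalRing L v)ˣ}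
    (hι : ((endoEmbLocal L v γH).val : GL (Fin 3) (UnitaryGroup.LocalRing L v)) = glDiagonal 3 (UnitaryGroup.LocalRing L v) d)
    (hreg : ∀ i j, i ≠ j → IsUnit ((d i : UnitaryGroup.LocalRing L v) - d j)) :
    finKappaAt L v H γH (cmDatumLocalCongr L v T ha h (endoEmbLocal L v γH)) =
      if ∃ z : UnitaryGroup.LocalRing L v, IsUnit z ∧ a = z * conjLocal L (IsCMField.complexConj L) v z then 1 else -1 := by
  have hc := IsCMField.complexConj_ne_one L
  haveI : Algebra.IsQuadraticExtension ↥(maximalRealSubfield L) L := IsCMField.isQuadraticExtension L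
  have hvs : Subsingleton (PlacesOver L v) := PlacesOver.subsingleton_of_smul_eq (IsCMField.complexConj L) hc w hw
  haveI : Nontrivial (UnitaryGroup.LocalRing L v) := ⟨⟨0, 1, fun h01 => zero_ne_one (congrFun h01 w)⟩⟩
  have ht := endoEmbLocal_mem_torusU_of_endoEmbLocal_eq L v γH hι
  have ha01 : IsUnit ((((d 0)⁻¹ * d 1 : (UnitaryGroup.LocalRing L v)ˣ) : UnitaryGroup.LocalRing L v) - 1) :=
    (HeisRing.isUnit_coe_inv_mul_sub_one_iff d 0 1).2 (hreg 1 0 (by decide))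
  have hu : IsUnit ((finCharpolyTwo L v γH).eval (finGammaTwo L v γH)) := by
    rw [eval_finCharpolyTwo_eq_of_endoEmbLocal_eq L v γH hι]
    exact HeisRing.isUnit_weylNumerator (conjLocal L (IsCMField.complexConj L) v) (cmLocalForm_eq_over L 3 v) ⟨_, ht⟩ hι.symm ha01
  -- the frame supplies the norm pair `ι_v(γ_H) ↔ e(ι_v γ_H)`
  have h₀ : IsLocalNormPair L H v γH (cmDatumLocalCongr L v T ha h (endoEmbLocal L v γH)) :=
    (isLocalNormPair_iff L H v γH _).2 (corresponds_cmDatumLocalCongr L v T ha h (endoEmbLocal L v γH))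
  -- the matrix of `γ₀ = e(ι_v γ_H)` is `T · diag(d) · T⁻¹`
  have hγ₀ : ((cmDatumLocalCongr L v T ha h (endoEmbLocal L v γH)).val.val : Matrix (Fin 3) (Fin 3) (UnitaryGroup.LocalRing L v)) =
      (T.val : Matrix (Fin 3) (Fin 3) (UnitaryGroup.LocalRing L v)) * Matrix.diagonal (fun i => (d i : UnitaryGroup.LocalRing L v)) *
        ((T⁻¹ : GL (Fin 3) (UnitaryGroup.LocalRing L v)).val : Matrix (Fin 3) (Fin 3) (UnitaryGroup.LocalRing L v)) := by
    rw [coe_cmDatumLocalCongr_apply, Units.val_mul, Units.val_mul, hι, coe_glDiagonal]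
  -- the `u`-eigenvector `p′ = T e₁` (column `1` of `T`)
  have hp' : ((cmDatumLocalCongr L v T ha h (endoEmbLocal L v γH)).val.val : Matrix (Fin 3) (Fin 3) (UnitaryGroup.LocalRing L v)) *ᵥ
        (fun i => (T.val : Matrix (Fin 3) (Fin 3) (UnitaryGroup.LocalRing L v)) i 1) =
      finGammaTwo L v γH • (fun i => (T.val : Matrix (Fin 3) (Fin 3) (UnitaryGroup.LocalRing L v)) i 1) := by
    rw [hγ₀, finGammaTwo_eq_of_endoEmbLocal_eq L v γH hι]
    have h1 : ((T.val : Matrix (Fin 3) (Fin 3) (UnitaryGroup.LocalRing L v)) * Matrix.diagonal (fun i => (d i : UnitaryGroup.LocalRing L v)) *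
        ((T⁻¹ : GL (Fin 3) (UnitaryGroup.LocalRing L v)).val : Matrix (Fin 3) (Fin 3) (UnitaryGroup.LocalRing L v))) *ᵥ
          (fun i => (T.val : Matrix (Fin 3) (Fin 3) (UnitaryGroup.LocalRing L v)) i 1) =
        fun i => (((T.val : Matrix (Fin 3) (Fin 3) (UnitaryGroup.LocalRing L v)) * Matrix.diagonal (fun i => (d i : UnitaryGroup.LocalRing L v)) *
          ((T⁻¹ : GL (Fin 3) (UnitaryGroup.LocalRing L v)).val : Matrix (Fin 3) (Fin 3) (UnitaryGroup.LocalRing L v))) *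
            (T.val : Matrix (Fin 3) (Fin 3) (UnitaryGroup.LocalRing L v))) i 1 := by
      funext i
      rfl
    have h2 : (T.val : Matrix (Fin 3) (Fin 3) (UnitaryGroup.LocalRing L v)) * Matrix.diagonal (fun i => (d i : UnitaryGroup.LocalRing L v)) *
          ((T⁻¹ : GL (Fin 3) (UnitaryGroup.LocalRing L v)).val : Matrix (Fin 3) (Fin 3) (UnitaryGroup.LocalRing L v)) *
          (T.val : Matrix (Fin 3) (Fin 3) (UnitaryGroup.LocalRing L v)) =
        (T.val : Matrix (Fin 3) (Fin 3) (UnitaryGroup.LocalRing L v)) * Matrix.diagonal (fun i => (d i : UnitaryGroup.LocalRing L v)) := by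
      rw [Matrix.mul_assoc, ← Units.val_mul, inv_mul_cancel, Units.val_one, Matrix.mul_one]
    rw [h1, h2]
    funext i
    rw [Matrix.mul_diagonal, Pi.smul_apply, smul_eq_mul, mul_comm]
  have hne : (fun i => (T.val : Matrix (Fin 3) (Fin 3) (UnitaryGroup.LocalRing L v)) i 1) ≠ 0 := by
    intro h0
    have hdet : IsUnit (T.val : Matrix (Fin 3) (Fin 3) (UnitaryGroup.LocalRing L v)).det := Matrix.isUnits_det_units T
    rw [Matrix.det_eq_zero_of_column_eq_zero 1 (fun i => congrFun h0 i)] at hdet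
    exact not_isUnit_zero hdet
  -- the relative position of `p′` is the multiplier: `x₀(T e₁) = (formCongr σ T H_v)₁₁ = a`
  have hΦ : ((Matrix.of fun i j : Fin 3 => if i.val + j.val + 1 = 3 then (1 : L) else 0).map (algebraMap L (UnitaryGroup.LocalRing L v))) 1 1 = 1 := by
    rw [Matrix.map_apply, Matrix.of_apply, if_pos (by decide), map_one]
  have hsum : (∑ i : Fin 3, ∑ k : Fin 3, conjLocal L (IsCMField.complexConj L) v ((fun i => (T.val : Matrix (Fin 3) (Fin 3) (UnitaryGroup.LocalRing L v)) i 1) i) *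
        ((adelicForm L 3 H).map (adeleToLocal L v)) i k * (fun i => (T.val : Matrix (Fin 3) (Fin 3) (UnitaryGroup.LocalRing L v)) i 1) k) = a := by
    have h11 := congrArg (fun M : Matrix (Fin 3) (Fin 3) (UnitaryGroup.LocalRing L v) => M 1 1) h
    simp only [Matrix.smul_apply, hΦ, smul_eq_mul, mul_one] at h11
    rw [← h11, adelicForm_map_adeleToLocal, Finset.sum_comm]
    simp only [formCongr, Matrix.mul_apply, Matrix.transpose_apply, Matrix.map_apply, Finset.sum_mul]
  rw [finKappaAt_eq_ite_of_eigenvector L v H γH _ hvs h₀ hu hp' hne, hsum]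

open scoped Classical in
/-- **`Δ‴_v` ON THE LEVI STRATUM OF THE INNER FORM, THROUGH THE FRAME**: `Δ‴_v(γ_H, e(ι_v γ_H)) = τ_v(γ_H) · D_{G∕H,v}(γ_H) · ω_{L_w∕L⁺_v}(a)` — ★
`finExplicitDelta_of_isLocalNormPair` with the `κ`-factor evaluated by `finKappaAt_cmDatumLocalCongr_endoEmbLocal_eq_ite`.  This is the value the H→G substitution of
Lemma 4.9.2 (★ `LocalDeltaTransferLeviStratum.classOrbitalIntegral_eq_delta_mul_classOrbitalIntegral_of_levi_cmDatumLocalCongr`) feeds into van Dijk's torus formula.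
[cite: Rogawski1990, §4.9 p. 55, Lemma 4.9.2 p. 56; §4.3 p. 43; §14.6 p. 242] -/
theorem finExplicitDelta_cmDatumLocalCongr_endoEmbLocal_eq (H : Matrix (Fin 3) (Fin 3) L)
    {v : HeightOneSpectrum (𝓞 ↥(maximalRealSubfield L))} (w : PlacesOver L v) (hw : IsCMField.complexConj L • w.1 = w.1)
    (T : GL (Fin 3) (UnitaryGroup.LocalRing L v)) {a : UnitaryGroup.LocalRing L v} (ha : IsUnit a)
    (h : formCongr (conjLocal L (IsCMField.complexConj L) v) T (H.map (algebraMap L (UnitaryGroup.LocalRing L v))) =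
      a • (Matrix.of fun i j : Fin 3 => if i.val + j.val + 1 = 3 then (1 : L) else 0).map (algebraMap L (UnitaryGroup.LocalRing L v)))
    (μ : HeckeCharacter L)
    (γH : (cmDatum L 2 (Matrix.of fun i j : Fin 2 => if i.val + j.val + 1 = 2 then (1 : L) else 0)).Local v ×
      (cmDatum L 1 (Matrix.of fun i j : Fin 1 => if i.val + j.val + 1 = 1 then (1 : L) else 0)).Local v)
    {d : Fin 3 → (UnitaryGroup.LocalRing L v)ˣ}
    (hι : ((endoEmbLocal L v γH).val : GL (Fin 3) (UnitaryGroup.LocalRing L v)) = glDiagonal 3 (UnitaryGroup.LocalRing L v) d)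
    (hreg : ∀ i j, i ≠ j → IsUnit ((d i : UnitaryGroup.LocalRing L v) - d j)) :
    finExplicitDelta L v H γH μ (cmDatumLocalCongr L v T ha h (endoEmbLocal L v γH)) =
      finTau L v γH μ * (finWeylRatio L v γH : ℂ) *
        (((if ∃ z : UnitaryGroup.LocalRing L v, IsUnit z ∧ a = z * conjLocal L (IsCMField.complexConj L) v z then 1 else -1 : ℤ)) : ℂ) := by
  have h₀ : IsLocalNormPair L H v γH (cmDatumLocalCongr L v T ha h (endoEmbLocal L v γH)) :=
    (isLocalNormPair_iff L H v γH _).2 (corresponds_cmDatumLocalCongr L v T ha h (endoEmbLocal L v γH))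
  rw [finExplicitDelta_of_isLocalNormPair L v H γH μ h₀, finKappaAt_cmDatumLocalCongr_endoEmbLocal_eq_ite L H w hw T ha h γH hι hreg]

open scoped Classical in
/-- **When the multiplier `a` is a unit norm, `Δ‴_v(γ_H, e(ι_v γ_H)) = τ_v(γ_H) · D_{G∕H,v}(γ_H)`** (the case of the quasi-split group, `a = 1`, and of every good
place — then this is the sign of ★ `finExplicitDelta_eq_unitModulusChar_of_levi_of_nonsplit`). [cite: Rogawski1990, §4.9 p. 55, Prop. 4.9.1 (b)] -/
theorem finExplicitDelta_cmDatumLocalCongr_endoEmbLocal_eq_of_exists (H : Matrix (Fin 3) (Fin 3) L)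
    {v : HeightOneSpectrum (𝓞 ↥(maximalRealSubfield L))} (w : PlacesOver L v) (hw : IsCMField.complexConj L • w.1 = w.1)
    (T : GL (Fin 3) (UnitaryGroup.LocalRing L v)) {a : UnitaryGroup.LocalRing L v} (ha : IsUnit a)
    (h : formCongr (conjLocal L (IsCMField.complexConj L) v) T (H.map (algebraMap L (UnitaryGroup.LocalRing L v))) =
      a • (Matrix.of fun i j : Fin 3 => if i.val + j.val + 1 = 3 then (1 : L) else 0).map (algebraMap L (UnitaryGroup.LocalRing L v)))
    (μ : HeckeCharacter L)
    (γH : (cmDatum L 2 (Matrix.of fun i j : Fin 2 => if i.val + j.val + 1 = 2 then (1 : L) else 0)).Local v ×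
      (cmDatum L 1 (Matrix.of fun i j : Fin 1 => if i.val + j.val + 1 = 1 then (1 : L) else 0)).Local v)
    {d : Fin 3 → (UnitaryGroup.LocalRing L v)ˣ}
    (hι : ((endoEmbLocal L v γH).val : GL (Fin 3) (UnitaryGroup.LocalRing L v)) = glDiagonal 3 (UnitaryGroup.LocalRing L v) d)
    (hreg : ∀ i j, i ≠ j → IsUnit ((d i : UnitaryGroup.LocalRing L v) - d j))
    (hnorm : ∃ z : UnitaryGroup.LocalRing L v, IsUnit z ∧ a = z * conjLocal L (IsCMField.complexConj L) v z) :
    finExplicitDelta L v H γH μ (cmDatumLocalCongr L v T ha h (endoEmbLocal L v γH)) = finTau L v γH μ * (finWeylRatio L v γH : ℂ) := by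
  rw [finExplicitDelta_cmDatumLocalCongr_endoEmbLocal_eq L H w hw T ha h μ γH hι hreg, if_pos hnorm, Int.cast_one, mul_one]

open scoped Classical in
/-- **When the multiplier `a` is NOT a unit norm, `Δ‴_v(γ_H, e(ι_v γ_H)) = −(τ_v(γ_H) · D_{G∕H,v}(γ_H))`** — the tree's factor on the inner form is print's transported
factor times `ω_w(−det H) = −1` at such a place. [cite: Rogawski1990, §14.6 p. 242; §4.9 p. 55] -/
theorem finExplicitDelta_cmDatumLocalCongr_endoEmbLocal_eq_of_not_exists (H : Matrix (Fin 3) (Fin 3) L)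
    {v : HeightOneSpectrum (𝓞 ↥(maximalRealSubfield L))} (w : PlacesOver L v) (hw : IsCMField.complexConj L • w.1 = w.1)
    (T : GL (Fin 3) (UnitaryGroup.LocalRing L v)) {a : UnitaryGroup.LocalRing L v} (ha : IsUnit a)
    (h : formCongr (conjLocal L (IsCMField.complexConj L) v) T (H.map (algebraMap L (UnitaryGroup.LocalRing L v))) =
      a • (Matrix.of fun i j : Fin 3 => if i.val + j.val + 1 = 3 then (1 : L) else 0).map (algebraMap L (UnitaryGroup.LocalRing L v)))
    (μ : HeckeCharacter L)
    (γH : (cmDatum L 2 (Matrix.of fun i j : Fin 2 => if i.val + j.val + 1 = 2 then (1 : L) else 0)).Local v ×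
      (cmDatum L 1 (Matrix.of fun i j : Fin 1 => if i.val + j.val + 1 = 1 then (1 : L) else 0)).Local v)
    {d : Fin 3 → (UnitaryGroup.LocalRing L v)ˣ}
    (hι : ((endoEmbLocal L v γH).val : GL (Fin 3) (UnitaryGroup.LocalRing L v)) = glDiagonal 3 (UnitaryGroup.LocalRing L v) d)
    (hreg : ∀ i j, i ≠ j → IsUnit ((d i : UnitaryGroup.LocalRing L v) - d j))
    (hnot : ¬ ∃ z : UnitaryGroup.LocalRing L v, IsUnit z ∧ a = z * conjLocal L (IsCMField.complexConj L) v z) :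
    finExplicitDelta L v H γH μ (cmDatumLocalCongr L v T ha h (endoEmbLocal L v γH)) = -(finTau L v γH μ * (finWeylRatio L v γH : ℂ)) := by
  rw [finExplicitDelta_cmDatumLocalCongr_endoEmbLocal_eq L H w hw T ha h μ γH hι hreg, if_neg hnot, Int.cast_neg, Int.cast_one, mul_neg_one]

end Literature.NumberTheory.Rogawski1990

end
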